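import Literature.Analysis.ODE.GlobalExistence
import Mathlib.Analysis.ODE.Gronwall
import Mathlib.Analysis.Complex.Basic
import HarnessLib

/-!
# Existence of solutions of a three-term ladder on a finite integer window

Topic `Literature/Analysis/ODE` (namespace `Literature.Analysis.ODE.IntWindowLadder`). Everything here is PROVED (no
definition, no named fact). The three-term ladder
`v_J' = −Λ(d_J v_J + g(t)(s_{J−1} v_{J−1} − s_J v_{J+1}))`, `J ∈ W ⊂ ℤ` finite, `v ≡ 0` off `W` (a Galerkin-truncated
shear-flow cell ladder), is a LINEAR system on the finite-dimensional space `↥W → ℂ` with a continuous coefficient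
`g`; it therefore has a (global) solution from every datum supported in `W` — local Picard–Lindelöf plus the linear
Grönwall a priori bound `‖v(t)‖ ≤ ‖v(t₀)‖e^{L(t−t₀)}`, i.e. the continuation principle
[cite: Teschl2012, Thm 2.2, Cor. 2.16 (linear growth ⇒ global)] as packaged in
`Literature.Analysis.ODE.exists_solution_of_apriori_bound`.

* `exists_solution_intWindow` — for `g` continuous, any `Λ, d, s`, any window `[t₀, t₁]` and any datum `v₀ : ℤ → ℂ`
  vanishing off `W`, there is `v : ℝ → ℤ → ℂ` with `v t₀ = v₀`, `v t J = 0` off `W`, and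
  `HasDerivWithinAt (v · J) (…) (Icc t₀ t₁) t` for all `t ∈ [t₀, t₁]`, `J ∈ W` — exactly the hypothesis block
  `(hsupp) (hderiv)` of `Literature.Analysis.ODE.IntWindowLadder.cone_intWindow` and its companions.

Use: the COLUMN trajectory `v¹` (datum `v_0(t₀)e_0`) that `split_intWindow` / `column_law_trapezoid` compare a
general trajectory with exists at the ladder level; no Galerkin-level auxiliary solution is needed.
-/

noncomputable section

namespace Literature.Analysis.ODE

namespace IntWindowLadder

open Set Metric Filter Topology
open scoped NNReal

/-- **Existence for the three-term ladder on a finite window.** [cite: Teschl2012, Thm 2.2, Cor. 2.16] -/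
theorem exists_solution_intWindow (W : Finset ℤ) (d s : ℤ → ℝ) (Λ t₀ t₁ : ℝ) (g : ℝ → ℝ) (hg : Continuous g)
    (v₀ : ℤ → ℂ) (hv₀ : ∀ J, J ∉ W → v₀ J = 0) :
    ∃ v : ℝ → ℤ → ℂ, (∀ J, v t₀ J = v₀ J) ∧ (∀ t J, J ∉ W → v t J = 0) ∧
      ∀ t ∈ Icc t₀ t₁, ∀ J ∈ W, HasDerivWithinAt (fun τ => v τ J)
        (-(Λ : ℂ) * ((d J : ℂ) * v t J) - (g t : ℂ) * (Λ : ℂ) * ((s (J - 1) : ℂ) * v t (J - 1) - (s J : ℂ) * v t (J + 1)))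
        (Icc t₀ t₁) t := by
  classical
  -- zero extension off `W` and the vector field on `↥W → ℂ`
  set xext : (↥W → ℂ) → ℤ → ℂ := fun x K => if h : K ∈ W then x ⟨K, h⟩ else 0 with hxdef
  set F : ℝ → (↥W → ℂ) → (↥W → ℂ) := fun t x J =>
    -(Λ : ℂ) * ((d J : ℂ) * x J) -
      (g (t₀ + t) : ℂ) * (Λ : ℂ) * ((s (J - 1) : ℂ) * xext x (J - 1) - (s J : ℂ) * xext x (J + 1)) with hFdef
  -- elementary bounds
  have hxn : ∀ (x : ↥W → ℂ) K, ‖xext x K‖ ≤ ‖x‖ := by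
    intro x K
    simp only [hxdef]
    split_ifs with h
    · exact norm_le_pi_norm x ⟨K, h⟩
    · rw [norm_zero]; exact norm_nonneg _
  have hxl : ∀ (x y : ↥W → ℂ) K, xext (x - y) K = xext x K - xext y K := by
    intro x y K
    simp only [hxdef]
    split_ifs <;> simp
  set Dm : ℝ := ∑ J ∈ W, |d J| with hDm
  set Sm : ℝ := ∑ J ∈ W, (|s (J - 1)| + |s J|) with hSm
  have hDm0 : 0 ≤ Dm := Finset.sum_nonneg fun J _ => abs_nonneg _
  have hSm0 : 0 ≤ Sm := Finset.sum_nonneg fun J _ => by positivity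
  have hdJ : ∀ J : ↥W, |d J| ≤ Dm := fun J =>
    Finset.single_le_sum (f := fun K => |d K|) (fun K _ => abs_nonneg _) J.2
  have hsJ : ∀ J : ↥W, |s (J - 1)| + |s J| ≤ Sm := fun J =>
    Finset.single_le_sum (f := fun K => |s (K - 1)| + |s K|) (fun K _ => by positivity) J.2
  -- the field is linear with an explicit norm bound
  have hlin : ∀ t x y, F t x - F t y = F t (x - y) := by
    intro t x y
    funext J
    simp only [hFdef, Pi.sub_apply, hxl]
    ring
  have hbd : ∀ t z, ‖F t z‖ ≤ (|Λ| * Dm + |g (t₀ + t)| * |Λ| * Sm) * ‖z‖ := by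
    intro t z
    have hC : 0 ≤ (|Λ| * Dm + |g (t₀ + t)| * |Λ| * Sm) * ‖z‖ := by positivity
    rw [pi_norm_le_iff_of_nonneg hC]
    intro J
    simp only [hFdef]
    have h1 : ‖-(Λ : ℂ) * ((d J : ℂ) * z J)‖ ≤ |Λ| * (Dm * ‖z‖) := by
      rw [norm_mul, norm_neg, norm_mul, Complex.norm_real, Complex.norm_real, Real.norm_eq_abs, Real.norm_eq_abs]
      exact mul_le_mul_of_nonneg_left (mul_le_mul (hdJ J) (norm_le_pi_norm z J) (norm_nonneg _) hDm0)
        (abs_nonneg _)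
    have h2 : ‖(g (t₀ + t) : ℂ) * (Λ : ℂ) * ((s (J - 1) : ℂ) * xext z (J - 1) - (s J : ℂ) * xext z (J + 1))‖ ≤
        |g (t₀ + t)| * |Λ| * (Sm * ‖z‖) := by
      rw [norm_mul, norm_mul, Complex.norm_real, Complex.norm_real, Real.norm_eq_abs, Real.norm_eq_abs]
      refine mul_le_mul_of_nonneg_left ?_ (by positivity)
      calc ‖(s ((J : ℤ) - 1) : ℂ) * xext z (J - 1) - (s J : ℂ) * xext z (J + 1)‖
          ≤ ‖(s ((J : ℤ) - 1) : ℂ) * xext z (J - 1)‖ + ‖(s J : ℂ) * xext z (J + 1)‖ := norm_sub_le _ _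
        _ = |s ((J : ℤ) - 1)| * ‖xext z (J - 1)‖ + |s J| * ‖xext z (J + 1)‖ := by
            rw [norm_mul, norm_mul, Complex.norm_real, Complex.norm_real, Real.norm_eq_abs, Real.norm_eq_abs]
        _ ≤ |s ((J : ℤ) - 1)| * ‖z‖ + |s J| * ‖z‖ :=
            add_le_add (mul_le_mul_of_nonneg_left (hxn z _) (abs_nonneg _))
              (mul_le_mul_of_nonneg_left (hxn z _) (abs_nonneg _))
        _ = (|s ((J : ℤ) - 1)| + |s J|) * ‖z‖ := by ring
        _ ≤ Sm * ‖z‖ := mul_le_mul_of_nonneg_right (hsJ J) (norm_nonneg _)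
    calc _ ≤ ‖-(Λ : ℂ) * ((d J : ℂ) * z J)‖ +
          ‖(g (t₀ + t) : ℂ) * (Λ : ℂ) * ((s (J - 1) : ℂ) * xext z (J - 1) - (s J : ℂ) * xext z (J + 1))‖ :=
          norm_sub_le _ _
      _ ≤ |Λ| * (Dm * ‖z‖) + |g (t₀ + t)| * |Λ| * (Sm * ‖z‖) := add_le_add h1 h2
      _ = (|Λ| * Dm + |g (t₀ + t)| * |Λ| * Sm) * ‖z‖ := by ring
  -- Lipschitz on balls, uniformly on compact time intervals
  have hlip : ∀ T ρ : ℝ, ∃ K : ℝ≥0, ∀ t ∈ Icc 0 T, LipschitzOnWith K (F t) (closedBall 0 ρ) := by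
    intro T ρ
    obtain ⟨G, hG⟩ := (isCompact_Icc (a := (0:ℝ)) (b := T)).exists_bound_of_continuousOn
      ((hg.comp (continuous_const.add continuous_id)).continuousOn (s := Icc 0 T))
    refine ⟨Real.toNNReal (|Λ| * Dm + G * |Λ| * Sm), fun t ht => ?_⟩
    refine (LipschitzWith.of_dist_le_mul fun x y => ?_).lipschitzOnWith
    rw [dist_eq_norm, dist_eq_norm, hlin]
    refine (hbd t (x - y)).trans (mul_le_mul_of_nonneg_right ?_ (norm_nonneg _))
    refine le_trans ?_ (Real.le_coe_toNNReal _)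
    have hGt : |g (t₀ + t)| ≤ G := by simpa [Real.norm_eq_abs] using hG t ht
    linarith [mul_le_mul_of_nonneg_right hGt (mul_nonneg (abs_nonneg Λ) hSm0)]
  -- continuity in time
  have hcont : ∀ x, ContinuousOn (F · x) (Ici 0) := by
    intro x
    refine Continuous.continuousOn ?_
    simp only [hFdef]
    refine continuous_pi fun J => ?_
    have hgc : Continuous fun t : ℝ => ((g (t₀ + t) : ℝ) : ℂ) :=
      Complex.continuous_ofReal.comp (hg.comp (continuous_const.add continuous_id))
    exact continuous_const.sub ((hgc.mul continuous_const).mul continuous_const)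
  -- datum and a priori bound (linear Grönwall)
  set x₀ : ↥W → ℂ := fun J => v₀ J with hx₀
  have hapriori : ∀ T : ℝ, 0 ≤ T → ∃ R : ℝ, ‖x₀‖ ≤ R ∧ ∀ s' ∈ Icc 0 T, ∀ α : ℝ → (↥W → ℂ), α 0 = x₀ →
      (∀ t ∈ Icc 0 s', HasDerivWithinAt α (F t (α t)) (Icc 0 s') t) → ∀ t ∈ Icc 0 s', ‖α t‖ ≤ R := by
    intro T hT
    obtain ⟨G, hG⟩ := (isCompact_Icc (a := (0:ℝ)) (b := T)).exists_bound_of_continuousOn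
      ((hg.comp (continuous_const.add continuous_id)).continuousOn (s := Icc 0 T))
    have hG0 : 0 ≤ G := le_trans (norm_nonneg _) (hG 0 (left_mem_Icc.2 hT))
    set L : ℝ := |Λ| * Dm + G * |Λ| * Sm with hL
    have hL0 : 0 ≤ L := by positivity
    refine ⟨‖x₀‖ * Real.exp (L * T), ?_, ?_⟩
    · have : 1 ≤ Real.exp (L * T) := Real.one_le_exp (by positivity)
      nlinarith [norm_nonneg x₀]
    intro s' hs' α hα0 hα t ht
    have hcα : ContinuousOn α (Icc 0 s') := fun τ hτ => (hα τ hτ).continuousWithinAt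
    have hder : ∀ τ ∈ Ico 0 s', HasDerivWithinAt α (F τ (α τ)) (Ici τ) τ := by
      intro τ hτ
      refine (hα τ ⟨hτ.1, hτ.2.le⟩).mono_of_mem_nhdsWithin ?_
      exact mem_of_superset (Icc_mem_nhdsGE hτ.2) (Icc_subset_Icc hτ.1 le_rfl)
    have hbound : ∀ τ ∈ Ico 0 s', ‖F τ (α τ)‖ ≤ L * ‖α τ‖ + 0 := by
      intro τ hτ
      rw [add_zero]
      refine (hbd τ (α τ)).trans (mul_le_mul_of_nonneg_right ?_ (norm_nonneg _))
      have hGt : |g (t₀ + τ)| ≤ G := by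
        simpa [Real.norm_eq_abs] using hG τ ⟨hτ.1, hτ.2.le.trans hs'.2⟩
      rw [hL]; linarith [mul_le_mul_of_nonneg_right hGt (mul_nonneg (abs_nonneg Λ) hSm0)]
    have key := norm_le_gronwallBound_of_norm_deriv_right_le hcα hder (le_of_eq (by rw [hα0])) hbound t ht
    rw [gronwallBound_ε0, sub_zero] at key
    refine key.trans (mul_le_mul_of_nonneg_left ?_ (norm_nonneg _))
    exact Real.exp_le_exp.2 (mul_le_mul_of_nonneg_left (ht.2.trans hs'.2) hL0)
  obtain ⟨α, hα0, hα⟩ := exists_solution_of_apriori_bound hlip hcont hapriori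
  -- back to window time and to `ℤ → ℂ`
  refine ⟨fun t K => xext (α (t - t₀)) K, ?_, ?_, ?_⟩
  · intro J
    simp only [sub_self, hα0, hxdef, hx₀]
    split_ifs with h
    · rfl
    · exact (hv₀ J h).symm
  · intro t J hJ
    simp only [hxdef, dif_neg hJ]
  · intro t ht J hJ
    have hT := hα (t₁ - t₀) (t - t₀) ⟨by linarith [ht.1], by linarith [ht.2]⟩
    -- compose with the translation `τ ↦ τ − t₀`
    have hshift : HasDerivWithinAt (fun τ : ℝ => τ - t₀) (1 : ℝ) (Icc t₀ t₁) t :=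
      (hasDerivWithinAt_id t _).sub_const t₀
    have hmaps : MapsTo (fun τ : ℝ => τ - t₀) (Icc t₀ t₁) (Icc 0 (t₁ - t₀)) :=
      fun τ hτ => ⟨by linarith [hτ.1], by linarith [hτ.2]⟩
    have hcomp := hT.scomp t hshift hmaps
    rw [one_smul] at hcomp
    have hJ' := (hasDerivWithinAt_pi.1 hcomp) ⟨J, hJ⟩
    simp only [Function.comp_def] at hJ'
    have e : (fun τ => xext (α (τ - t₀)) J) = fun τ => α (τ - t₀) ⟨J, hJ⟩ := by
      funext τ; simp only [hxdef, dif_pos hJ]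
    rw [e]
    refine hJ'.congr_deriv ?_
    simp only [hFdef, hxdef, dif_pos hJ, add_sub_cancel]

end IntWindowLadder

end Literature.Analysis.ODE
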